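import Summits.QuantumFields.BalabanUV.Beta.GAN24.DirichletExhaustionDeltaZ

/-!
# `BalabanUV.Beta.GAN24.DirichletExhaustionDeltaZSymm` — binder row G-an2-4 / (CONV-C), part P2, PART 9 = skeleton node S1.b: the kernel
# `deltaZ` of PART 8 (Bałaban's `U = 1` action `Δ_k` on the bonds of `ℤ^{d+1}`) is SYMMETRIC — input (in3) of PART 5's `CovInput` for this object
# (unit b2b-balaban-gan24-p2, gen 1, v1)

HONEST FRAMING (cell contract, verbatim): «discharging `BetaPertH` makes Bałaban's UV stability UNCONDITIONAL — a real constructive-QFT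
result; it is NOT the continuum limit and NOT the Clay problem.»  Bookkeeping: the reflection/conjugation identity of the `ℤ^{d+1}` lattice
Fourier coefficient (`latticeKernel G (−x) = conj (latticeKernel (conj ∘ G) x)`, b04's `B4ContourShift.latticeKernel`), the conjugation
symmetry of the real-momentum (1.66) entry symbols (`conj Gsym_{ab} = Gsym_{ba}` on the Brillouin zone, from b05's `B5Symbol166Strip.Gsym_ofReal`
/ `Gsym_ofReal_zero`: `w166` is real), hence `kerRe n μ ν a b (−z) = kerRe n μ ν b a z` and `deltaZ L k p q = deltaZ L k q p`.  [folklore]; nothing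
of the wall is touched; NOT `BetaPertH`, NOT continuum, NOT Clay.  «not in print; our proof attempt».

ABSOLUTE RULE (cell, verbatim): «No internally-minted statement may enter as a cited fact. Every hypothesis is either kernel-proved in this
package or a verbatim quotation of a PUBLISHED theorem with page reference. The manuscript(s) under audit are NOT citable for their own disputed
steps — they are the thing under adjudication; programme-internal (2001/route/tribunal) claims are never citable.»

WHAT IS PROVED (0 sorry): `conj_integrand`, `fourierBox_neg`, `latticeKernel_neg`, `latticeKernel_congr_BZ`, `conj_Gsym_ofReal`, `kerRe_neg`, `summand_swap`, **`deltaZ_symm`**,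
and the three `Δ`-fields of `CovInput` for `deltaZ L` packaged: `deltaZ_inputs3`.  NOT summit progress.
-/

namespace Summit.QuantumFields.BalabanUV.Beta.GAN24.DirichletExhaustionDeltaZSymm

open Finset Real MeasureTheory Complex
open Literature.MathematicalPhysics.QuantumFieldTheory.Balaban1983to89
open B4Strip (ofRealVec)
open B4ContourShift (BZ phase integrand fourierBox latticeKernel)
open B5Symbol166Strip (Gsym Gsym_ofReal Gsym_ofReal_zero)
open T4GaugeActionRatePair (kerRe kerFamily)
open B4Sect5Exhaustion (K)
open Summit.QuantumFields.BalabanUV.Beta.GAN24.DirichletExhaustion (OpClose)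
open Summit.QuantumFields.BalabanUV.Beta.GAN24.DirichletExhaustionDeltaZ

noncomputable section

variable {d : ℕ}

/-! ## §1 Reflection = conjugation for lattice Fourier coefficients -/

/-- The phase is real: `conj (phase p x) = phase p x`. -/
theorem conj_phase (p : Fin (d + 1) → ℝ) (x : Fin (d + 1) → ℤ) : (starRingEnd ℂ) (phase p x) = phase p x := by
  rw [B4ContourShift.phase_eq_ofReal, Complex.conj_ofReal]

/-- `phase p (−x) = −phase p x`. -/
theorem phase_neg (p : Fin (d + 1) → ℝ) (x : Fin (d + 1) → ℤ) : phase p (-x) = -phase p x := by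
  unfold phase
  rw [← Finset.sum_neg_distrib]
  refine Finset.sum_congr rfl fun μ _ => ?_
  simp only [Pi.neg_apply, Int.cast_neg]; ring

/-- `conj (G(p) e^{i p·x}) = conj G(p) · e^{i p·(−x)}`: the integrand at `−x` of `conj ∘ G` is the conjugate of the integrand of `G`. -/
theorem conj_integrand (G : (Fin (d + 1) → ℂ) → ℂ) (x : Fin (d + 1) → ℤ) (p : Fin (d + 1) → ℝ) :
    (starRingEnd ℂ) (integrand G x p) = integrand (fun q => (starRingEnd ℂ) (G q)) (-x) p := by
  unfold integrand
  rw [map_mul, ← Complex.exp_conj, map_mul, Complex.conj_I, conj_phase, phase_neg]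
  ring_nf

/-- **Reflection identity** for the box Fourier integral: `fourierBox G (−x) = conj (fourierBox (conj ∘ G) x)`. -/
theorem fourierBox_neg (G : (Fin (d + 1) → ℂ) → ℂ) (x : Fin (d + 1) → ℤ) :
    fourierBox G (-x) = (starRingEnd ℂ) (fourierBox (fun q => (starRingEnd ℂ) (G q)) x) := by
  unfold fourierBox
  rw [← integral_conj]
  refine setIntegral_congr_fun measurableSet_Icc fun p _ => ?_
  rw [conj_integrand]
  simp

/-- `latticeKernel G (−x) = conj (latticeKernel (conj ∘ G) x)`. -/
theorem latticeKernel_neg (G : (Fin (d + 1) → ℂ) → ℂ) (x : Fin (d + 1) → ℤ) :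
    latticeKernel G (-x) = (starRingEnd ℂ) (latticeKernel (fun q => (starRingEnd ℂ) (G q)) x) := by
  unfold latticeKernel
  rw [fourierBox_neg, Complex.real_smul, Complex.real_smul, map_mul, Complex.conj_ofReal]

/-! ## §2 Conjugation symmetry of the (1.66) entry symbols on the real zone -/

/-- On the Brillouin zone, `conj (Gsym n μ ν a b) = Gsym n μ ν b a` (`w166` is real; at the origin both vanish). -/
theorem conj_Gsym_ofReal (n : ℕ) [NeZero n] {μ ν : Fin (d + 1)} (hμν : μ ≠ ν) (a b : Fin (d + 1))
    {s : Fin (d + 1) → ℝ} (hs : s ∈ BZ (d + 1)) :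
    (starRingEnd ℂ) (Gsym n μ ν a b (ofRealVec s)) = Gsym n μ ν b a (ofRealVec s) := by
  have hsπ : ∀ κ, |s κ| ≤ Real.pi := by
    intro κ
    have h := hs
    simp only [BZ, Set.mem_Icc, Pi.le_def] at h
    exact abs_le.2 ⟨h.1 κ, h.2 κ⟩
  by_cases h0 : ∃ ν₀, s ν₀ ≠ 0
  · obtain ⟨ν₀, hν₀⟩ := h0
    rw [Gsym_ofReal n hμν a b s hsπ ν₀ hν₀, Gsym_ofReal n hμν b a s hsπ ν₀ hν₀]
    simp only [map_mul, map_div₀, map_one, map_ofNat, Complex.conj_ofReal, Complex.conj_conj]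
    ring
  · push Not at h0
    have hs0 : s = fun _ => (0 : ℝ) := funext h0
    subst hs0
    rw [Gsym_ofReal_zero, Gsym_ofReal_zero, map_zero]

/-- Lattice kernels only see the multiplier ON THE REAL ZONE: multipliers agreeing on `BZ` have the same coefficients. -/
theorem latticeKernel_congr_BZ {G G' : (Fin (d + 1) → ℂ) → ℂ} (h : ∀ s ∈ BZ (d + 1), G (ofRealVec s) = G' (ofRealVec s))
    (x : Fin (d + 1) → ℤ) : latticeKernel G x = latticeKernel G' x := by
  unfold latticeKernel fourierBox
  congr 1
  refine setIntegral_congr_fun measurableSet_Icc fun p hp => ?_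
  unfold integrand
  rw [h p hp]

/-- **`kerRe n μ ν a b (−z) = kerRe n μ ν b a z`** (reflection swaps the two form-factor slots). -/
theorem kerRe_neg (n : ℕ) [NeZero n] {μ ν : Fin (d + 1)} (hμν : μ ≠ ν) (a b : Fin (d + 1)) (z : Fin (d + 1) → ℤ) :
    kerRe n μ ν a b (-z) = kerRe n μ ν b a z := by
  unfold kerRe
  rw [latticeKernel_neg, Complex.conj_re, latticeKernel_congr_BZ (fun s hs => conj_Gsym_ofReal n hμν a b hs)]

/-! ## §3 Symmetry of `deltaZ` -/

/-- Swapping `(α, z) ↔ (β, −z)` in the summand of an entry family with the reflection law `Kf a b (−z) = Kf b a z` gives the same value. -/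
theorem summand_swap {Kf : Fin (d + 1) → Fin (d + 1) → (Fin (d + 1) → ℤ) → ℝ}
    (hK : ∀ a b z, Kf a b (-z) = Kf b a z) (μ ν α β : Fin (d + 1)) (z : Fin (d + 1) → ℤ) :
    summand Kf μ ν β α (-z) = summand Kf μ ν α β z := by
  unfold summand
  rw [hK, hK, hK, hK]
  ring

/-- **`deltaZ` IS SYMMETRIC**: `deltaZ L k p q = deltaZ L k q p` — input (in3) of PART 5's `CovInput` for Bałaban's `Δ_k`. -/
theorem deltaZ_symm (L : ℕ) [NeZero L] (k : ℕ) (p q : K (d + 1) (d + 1)) : deltaZ L k p q = deltaZ L k q p := by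
  unfold deltaZ
  refine Finset.sum_congr rfl fun μ _ => Finset.sum_congr rfl fun ν _ => ?_
  split_ifs with h
  · rfl
  · have hz : q.1 - p.1 = -(p.1 - q.1) := by abel
    rw [hz, summand_swap (fun a b z => ?_) μ ν p.2 q.2 (p.1 - q.1)]
    unfold kerFamily
    exact kerRe_neg (L ^ k) h a b z

/-- The three `Δ`-fields of `CovInput` (PART 5) for `Δ := deltaZ L`, packaged: decay, symmetry, operator step-rate (`θ = L⁻²`). -/
theorem deltaZ_inputs3 (L : ℕ) [NeZero L] :
    (∀ k (r s : K (d + 1) (d + 1)), |deltaZ L k r s| ≤ c166Z d * Real.exp (-(kappaZ d * dist r.1 s.1))) ∧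
    (∀ k (r s : K (d + 1) (d + 1)), deltaZ L k r s = deltaZ L k s r) ∧
    (∀ k, OpClose (Set.univ : Set (Fin (d + 1) → ℤ)) (deltaZ L k) (deltaZ L (k + 1))
      (theta166Z d * (((L : ℝ) ^ 2)⁻¹) ^ k) (kappaZ d)) :=
  ⟨fun k r s => deltaZ_abs_le L k r s, fun k r s => deltaZ_symm L k r s, fun k => opClose_deltaZ L k⟩

end

end Summit.QuantumFields.BalabanUV.Beta.GAN24.DirichletExhaustionDeltaZSymm
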